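import Summits.QuantumAdvantage.QuantumAdvantage.Theorems.PhiHidingThree
import HarnessLib.Audit

set_option linter.dupNamespace false -- D-0017: single-problem summit ⇒ `QuantumAdvantage.QuantumAdvantage`

/-!
# Skeleton v4 — line `Sketch` (honda-leak arm) for crux `PureCubicClassNumberHard` (stmt-QuantumAdvantage-11826)

Route `LinnikCubicClassGroups`, rank-0 hypothesis-type target
`X = PureCubicClassNumberHard` : no PPT algorithm prints, on every input `x` with non-cube
`m = decodeNat x` and every cubic number field `K ∋ ∛m`, the `2|x|+8` low bits of `h_K` with
probability `≥ 2/3`.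

## State of the line (continuation lead c3, 2026-08-17): CLOSED MODULO ONE NAMED CONJECTURE

Every provable piece of skeletons v1–v3 is LANDED in `Theorems/` and is no longer restated here:

* reduction (window bound, `FP` post-processing, transfer): p86027 `stub_classNumber_le`,
  p87206 `stub_modThree_polyTime`, p90691 `hondaBitDecider_of_classNumberAlgorithm` /
  `pureCubicClassNumberHard_of_honda_of_phiHiding3` (`…HondaLeakTransfer.lean`);
* Honda's criterion on the promise family: split case `p ≡ 1 (3) ⟹ 3 ∣ h` = tree genus theory
  (`Literature…Honda1971.three_dvd_classNumber_of_mod_three_eq_one`); inert case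
  `p ≡ 2, q ≡ 5 (9) ⟹ 3 ∤ h` = the six CFT stubs p100832 `stub_fieldSetup`, p102749
  `stub_ramificationCensus`, p105532 `stub_zetaNotNorm`, p105720 `stub_unitsNormOne9`, p104554
  `stub_invariantIdealsPrincipal`, p105158 `stub_classNumber_not_dvd` (+ p99421 `stub_normNeZeta`,
  p99497 `stub_primeAbove`, p100159/p100728 genus files of the parallel lead), assembled in p111041
  `…Honda25.lean`: `honda25`, `three_dvd_classNumber_iff_of_promise` (= `HondaSplitVsInert`),
  `eisensteinTypeDecider_of_classNumberAlgorithm'`, `pureCubicClassNumberHard_of_phiHiding3 : ΦH3 → X`;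
* the leaf NAMED and audited: p133220 `Theorems/PhiHidingThree.lean` — `@[conjecture] def PhiHidingThree`
  (worst-case Φ-hiding for the fixed exponent `e = 3` on `N = pq ≡ 1 (9)` minus `(8,8)`,
  Cachin–Micali–Stadler 1999 §2), `phiHidingThree_iff_stub` (the conjecture ↔ the v3 stub, verbatim),
  `pureCubicClassNumberHard_of_phiHidingThree : PhiHidingThree → X`, and the wall:
  `quantumAdvantage_of_phiHidingThree` (the leaf ALONE proves the summit, via Shor: p114943/p115703),
  `P_ne_PSPACE_of_phiHidingThree`, `not_phiHidingThree_of_BQP_subset_BPP`,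
  `phiHidingThree_false_without_polyTime`; presentations p133413/p133916 (QR(−3), lossy RSA keys,
  Jacobi, 3-adic no-leak), i.o. form p133667.

So the composition below has exactly ONE stub, and that stub is — by name — the tree's registered
open conjecture `Theorems.PhiHidingThree`.  It is not a proof obligation: a sorry-free proof of it on
the standard axioms would prove `QuantumAdvantage` and `P ≠ PSPACE` inside the tree
(`quantumAdvantage_of_stub`, `P_ne_PSPACE_of_stub` below, kernel-checked modulo the sorry), and it
is false in any world with `BQP ⊆ BPP`.  The crux `X` itself is hypothesis-type for the same reason
(Disproof §8 `P_ne_PSPACE_of_crux_and_quantum_half`; STRATEGY-CENSUS: no-strategy-short-of-summit).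

## Disproof used (`Cruxes/PureCubicClassNumberHard/Disproof.lean`, cdisprove v4b, unchanged since 2026-08-16T06:39Z)
§3 `_false_without_PolyTime` honoured (the leaf keeps `IsPolyTime`; cf. `stub_false_without_polyTime`
in `PhiHidingThree.lean`), §7 infinitely-often form (`phiHidingThree_iff_infinitelyOften`),
`-- Targets`: none.

wave: none — 1 stub left, and it is a named `@[conjecture]` (no worker can be briefed on it).
-/

namespace Summit.QuantumAdvantage.QuantumAdvantage.Cruxes.PureCubicClassNumberHard.HondaLeak

open Literature.Computability.Complexity Literature.Computability.Complexity.Classes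
open Summit.QuantumAdvantage.QuantumAdvantage.Theses.LinnikCubicClassGroups (PureCubicClassNumberHard)
open Summit.QuantumAdvantage.QuantumAdvantage.Theorems
  (PhiHidingThree pureCubicClassNumberHard_of_phiHidingThree quantumAdvantage_of_phiHidingThree
    P_ne_PSPACE_of_phiHidingThree phiHidingThree_iff_stub)

/-! ### The one registered stub: the named open conjecture -/

/-- STUB 1 (HYPOTHESIS-TYPE LEAF = the tree's `@[conjecture] Theorems.PhiHidingThree`, p133220;
conjecture-grade, never staffed for proof) — worst-case Φ-hiding for the fixed exponent `e = 3`
(Cachin–Micali–Stadler 1999 §2; Kiltz–O'Neill–Smith 2010 §5.2 fn. 9) on the pure-cubic promise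
family `N = pq ≡ 1 (mod 9)`, not `p ≡ q ≡ 8 (mod 9)`: no PPT algorithm outputs `[3 ∣ φ(N)]` with
probability `≥ 2/3` on every member.  Up to `phiHidingThree_iff_stub` this is VERBATIM the v3 stub
`stub_phiHiding3` (same name kept).  Open both ways: it implies the summit and `P ≠ PSPACE`; it is
false under `BQP ⊆ BPP`. -/
theorem stub_phiHiding3 : Summit.QuantumAdvantage.QuantumAdvantage.Theorems.PhiHidingThree := by
  sorry

/-! ### The composition: the crux BY NAME from the stub -/

/-- **Skeleton theorem (v4).** `X` from the named leaf: `pureCubicClassNumberHard_of_phiHidingThree`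
(p133220) = `phiHidingThree_iff_stub` + the landed transfer `pureCubicClassNumberHard_of_phiHiding3`
(p111041: Honda's criterion on the promise family, PROVED, + the landed PPT reduction). -/
theorem PureCubicClassNumberHard_of : PureCubicClassNumberHard :=
  pureCubicClassNumberHard_of_phiHidingThree stub_phiHiding3

/-! ### Audit: the stub alone already gives the summit and `P ≠ PSPACE` (why it is not an obligation) -/

/-- **The stub implies the summit outright** (line summit-redundant w.r.t. the closed bridge route
`Shor`; kill criterion K1 of STUB-PLAN-stub_phiHiding3: a sorry-free `stub_phiHiding3` would settle
`QuantumAdvantage` — treat any such claim as an inconsistency hunt). -/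
theorem quantumAdvantage_of_stub : _root_.QuantumAdvantage :=
  quantumAdvantage_of_phiHidingThree stub_phiHiding3

/-- **The stub implies `P ≠ PSPACE`** (barrier `SeparationPrerequisites`, a theorem of the tree). -/
theorem P_ne_PSPACE_of_stub : P ≠ PSPACE :=
  P_ne_PSPACE_of_phiHidingThree stub_phiHiding3

/-- The v3 form of the stub, recovered from the v4 stub (so every `--supports` helper registered
against the v3 signature still reads as a statement about this skeleton's one open leaf). -/
theorem stub_phiHiding3_v3 :
    ¬ ∃ D : RandAlg (List Bool) Bool, D.IsPolyTime id _root_.Computability.encodeBool ∧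
      ∀ p q : ℕ, p.Prime → q.Prime → p ≠ q → (p * q) % 9 = 1 →
        ((p % 3 = 1 ∧ q % 3 = 1) ∨ (p % 9 = 2 ∧ q % 9 = 5) ∨ (p % 9 = 5 ∧ q % 9 = 2)) →
        (2 : ℝ) / 3 ≤ D.pr id (_root_.Computability.encodeNat (p * q)) {b | b = decide (p % 3 = 1)} :=
  phiHidingThree_iff_stub.mp stub_phiHiding3

end Summit.QuantumAdvantage.QuantumAdvantage.Cruxes.PureCubicClassNumberHard.HondaLeak
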